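import Summits.Ventures.HodgeKum4.Theorems.KummerFixedLocusFixedPointForm
import Summits.Ventures.HodgeKum4.Theorems.KummerFixedLocusKummerPointTransport
import Literature.AlgebraicGeometry.GroupActions.FixedPointScheme
import Mathlib.CategoryTheory.Limits.VanKampen
import Mathlib.CategoryTheory.Extensive
import Mathlib.AlgebraicGeometry.Limits
import Mathlib.CategoryTheory.Limits.Constructions.Over.Connected
import HarnessLib

/-!
# From "the fixed points of `g` are finitely many reduced points, exactly one on `W`" to the
fixed-point form of I1geo (cell `hodge-kum4`, seat p2 — the Kummer-point ASSEMBLY lemma)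

HONEST FRAMING.  Nothing here proves I1geo or the Hodge conjecture.  General-purpose plumbing
(§A category theory, §B schemes over `ℂ`), then the assembly (§C): if the fixed-point scheme
`j : F ⟶ X` of `⟨g⟩` is the COPRODUCT of finitely many sections `x k : Spec ℂ ⟶ F` (split finite
étale — the shape of the printed Kummer-point input, Oguiso 2020 Prop. 3.6:
`Hyperkaehler.Oguiso2020_fixedPointScheme_translation_generalizedKummerFour`) and EXACTLY ONE of the
points `x k ≫ j` lies on the closed subscheme `i : W ⟶ X`, then the `g`-fixed part of `W` is one
reduced point (the fixed-point form of `KummerFixedLocusFixedPointForm`).  Ingredients: coproducts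
of schemes are universal (Mathlib: `Scheme` is finitary extensive), transferred to `Over (Spec ℂ)`
through the forgetful functor; a closed subscheme of `Spec ℂ` is empty or everything.
§D applies this at the generalized Kummer varieties `K⁴(A)`:
`kum4FixedFourfoldMeetsTranslates_atKummerPoints_of_split_of_count` (Oguiso's split shape + the
printed `|Γ| = 625` + the POINT COUNT "exactly one of the `125` fixed points of `g` lies on `W₀`"
⇒ I1geo at every `K⁴(A)`), and `hc_kum4Type_of_L1_of_count` — the rung H3 (and its powers form)
from thirteen printed statements (eleven refereed facts, the cohomological transport, Oguiso's
fixed points), p1's L1, and that point count ALONE as the non-print residual.  Everything is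
CONDITIONAL on the named inputs; the point count is the cell's elementary, unpublished Kummer-point
statement (the coset `⟨u⟩` is the only `(−1)`-symmetric `⟨u⟩`-coset in `A[5]`, and lies on `W₀`).
-/

noncomputable section

open CategoryTheory CategoryTheory.Limits MonoidalCategory CartesianMonoidalCategory
open Literature.AlgebraicGeometry

namespace Summit.Ventures.HodgeKum4

/-! ### §A Category theory: maps into a universal coproduct -/

section CategoryTheory

universe v u

variable {C : Type u} [Category.{v} C] {ι : Type*} {P : ι → C}

/-- In a cofan that is a colimit, if all components but `k₀` are initial then the injection of
`k₀` is an isomorphism. -/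
theorem isIso_inj_of_isInitial [DecidableEq ι] {d : Cofan P} (hd : IsColimit d) (k₀ : ι)
    (h0 : ∀ i, i ≠ k₀ → IsInitial (P i)) : IsIso (d.inj k₀) := by
  -- the candidate inverse: identity on the `k₀` component, the unique map on the others
  let φ : ∀ i, P i ⟶ P k₀ := fun i =>
    if h : i = k₀ then eqToHom (congrArg P h) else (h0 i h).to (P k₀)
  have hφ : φ k₀ = 𝟙 (P k₀) := by simp [φ]
  refine ⟨⟨Cofan.IsColimit.desc hd φ, ?_, ?_⟩⟩
  · rw [Cofan.IsColimit.fac, hφ]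
  · refine Cofan.IsColimit.hom_ext hd _ _ fun i => ?_
    rw [← Category.assoc, Cofan.IsColimit.fac, Category.comp_id]
    by_cases hi : i = k₀
    · subst hi
      rw [hφ, Category.id_comp]
    · exact (h0 i hi).hom_ext _ _

/-- **Maps into a universal coproduct with all but one fibre empty.**  Let `a` be a universal
colimit cofan of `X : ι → C` (`IsUniversalColimit a`) and `t : T ⟶ a.pt`.  If the pull-backs
`Q i` of `t` along the injections `a.inj i` are initial for all `i ≠ k₀`, then `t` factors through
`a.inj k₀`. -/
theorem exists_fac_of_isUniversalColimit [DecidableEq ι] {X : ι → C} {a : Cofan X}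
    (hau : IsUniversalColimit a) {T : C} (t : T ⟶ a.pt) (Q : ι → C) (p : ∀ i, Q i ⟶ T)
    (q : ∀ i, Q i ⟶ X i) (hQ : ∀ i, IsPullback (p i) (q i) t (a.inj i)) (k₀ : ι)
    (h0 : ∀ i, i ≠ k₀ → IsInitial (Q i)) :
    ∃ s : T ⟶ X k₀, t = s ≫ a.inj k₀ := by
  -- the pull-backs form a coproduct decomposition of `T`
  have hT : Nonempty (IsColimit (Cofan.mk T p)) :=
    hau.nonempty_isColimit_of_isPullback_left (f := fun i => a.inj i) (u := 𝟙 a.pt) (v := t) p q hQ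
      (IsPullback.of_horiz_isIso (fst := 𝟙 T) (snd := t) (f := t) (g := 𝟙 a.pt) ⟨by simp⟩)
      (Cofan.mk T p) (Iso.refl T) (by simp)
      (fun i => by change p i ≫ 𝟙 T ≫ 𝟙 T = p i; simp only [Category.comp_id])
      (fun i => by change p i ≫ 𝟙 T ≫ t = q i ≫ a.inj i; rw [Category.id_comp]; exact (hQ i).w)
  obtain ⟨hT⟩ := hT
  haveI : IsIso (p k₀) := isIso_inj_of_isInitial hT k₀ h0
  refine ⟨inv (p k₀) ≫ q k₀, ?_⟩
  rw [Category.assoc, ← (hQ k₀).w, IsIso.inv_hom_id_assoc]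

end CategoryTheory

/-! ### §B Schemes over a base: transfer through the forgetful functor; empty fibres -/

section Schemes

open AlgebraicGeometry

universe u

/-- An object of `Over S` whose underlying scheme is empty is initial. -/
theorem nonempty_isInitial_over_of_isEmpty {S : Scheme.{u}} (Z : Over S) [IsEmpty Z.left] :
    Nonempty (IsInitial Z) :=
  ⟨IsInitial.ofUniqueHom
    (fun Y => Over.homMk (isInitialOfIsEmpty.to Y.left) (isInitialOfIsEmpty.hom_ext _ _))
    fun _ _ => Over.OverMorphism.ext (isInitialOfIsEmpty.hom_ext _ _)⟩

/-- **Maps into a split object of `Over S` with all but one fibre empty** (coproducts of schemes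
are universal — `Scheme` is finitary extensive — transferred through `Over.forget S`): if
`x : Fin n → (X k ⟶ F)` is a coproduct cofan in `Over S`, `t : T ⟶ F`, and the pull-backs of `t`
along the `x k`, `k ≠ k₀`, are initial, then `t` factors through `x k₀`. -/
theorem exists_fac_over {S : Scheme.{u}} {n : ℕ} {X : Fin n → Over S} {F : Over S}
    (x : ∀ k, X k ⟶ F) (ha : IsColimit (Cofan.mk F x)) {T : Over S} (t : T ⟶ F)
    (Q : Fin n → Over S) (p : ∀ k, Q k ⟶ T) (q : ∀ k, Q k ⟶ X k)
    (hQ : ∀ k, IsPullback (p k) (q k) t (x k)) (k₀ : Fin n) (h0 : ∀ k, k ≠ k₀ → IsInitial (Q k)) :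
    ∃ s : T ⟶ X k₀, t = s ≫ x k₀ := by
  classical
  have ha' : IsColimit (Cofan.mk F.left fun k => (x k).left) :=
    isColimitCofanMkObjOfIsColimit (Over.forget S) X x ha
  have hau : IsUniversalColimit (Cofan.mk F.left fun k => (x k).left) :=
    (FinitaryExtensive.isVanKampen_finiteCoproducts ha').isUniversal
  have hQ' : ∀ k, IsPullback (p k).left (q k).left t.left ((Cofan.mk F.left fun k => (x k).left).inj k) :=
    fun k => (hQ k).map (Over.forget S)
  have h0' : ∀ k, k ≠ k₀ → IsInitial (Q k).left := fun k hk => (h0 k hk).isInitialObj (Over.forget S) _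
  obtain ⟨s', hs'⟩ := exists_fac_of_isUniversalColimit hau t.left (fun k => (Q k).left)
    (fun k => (p k).left) (fun k => (q k).left) hQ' k₀ h0'
  change t.left = s' ≫ (x k₀).left at hs'
  have hs'w : s' ≫ (X k₀).hom = T.hom := by
    rw [← Over.w t, hs', Category.assoc, Over.w (x k₀)]
  exact ⟨Over.homMk s' hs'w, Over.OverMorphism.ext (by simpa using hs')⟩

/-- **No section over a point ⇒ empty fibre.**  Let `i : W ⟶ X` be a closed immersion of
`ℂ`-schemes and `y : Spec ℂ ⟶ X` a point such that NO point `p : Spec ℂ ⟶ W` has `i(p) = y`.  Then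
any `Z` carrying a `Z`-valued point `r` of `W` over `y` (`i ∘ r` constant `= y`) is empty (initial):
the fibre `W ×_X y` is a closed subscheme of `Spec ℂ`, hence empty or all of `Spec ℂ`. -/
theorem isEmpty_of_noSection {W X Z : Motives.SchemeOver ℂ} (i : W ⟶ X)
    [IsClosedImmersion i.left] (y : 𝟙_ (Motives.SchemeOver ℂ) ⟶ X)
    (hno : ∀ p : 𝟙_ (Motives.SchemeOver ℂ) ⟶ W, p ≫ i ≠ y) (r : Z ⟶ W)
    (hz : r ≫ i = toUnit Z ≫ y) : IsEmpty ↥Z.left := by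
  by_contra hZ
  rw [not_isEmpty_iff] at hZ
  obtain ⟨ζ⟩ := hZ
  -- `Z` maps to the fibre `V = W ×_X y`, a closed subscheme of `Spec ℂ`
  have hcomm : r.left ≫ i.left = (toUnit Z).left ≫ y.left := by
    rw [← Over.comp_left, hz, Over.comp_left]
  let z : Z.left ⟶ pullback i.left y.left := pullback.lift r.left (toUnit Z).left hcomm
  -- `V → Spec ℂ` is a surjective closed immersion into a reduced scheme, hence an isomorphism
  haveI : Nonempty ↥(pullback i.left y.left) := ⟨z.base ζ⟩
  haveI : Subsingleton ↥((𝟙_ (Motives.SchemeOver ℂ)).left) :=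
    inferInstanceAs (Subsingleton (PrimeSpectrum ℂ))
  haveI : Surjective (pullback.snd i.left y.left) :=
    ⟨fun s => ⟨z.base ζ, Subsingleton.elim _ _⟩⟩
  haveI : IsReduced (𝟙_ (Motives.SchemeOver ℂ)).left :=
    inferInstanceAs (IsReduced (Spec (CommRingCat.of ℂ)))
  haveI : IsIso (pullback.snd i.left y.left) := isIso_of_isClosedImmersion_of_surjective _
  -- the resulting section of `W` over `y`
  let p' : (𝟙_ (Motives.SchemeOver ℂ)).left ⟶ W.left :=
    inv (pullback.snd i.left y.left) ≫ pullback.fst i.left y.left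
  have hp'y : p' ≫ i.left = y.left := by
    rw [Category.assoc, pullback.condition, IsIso.inv_hom_id_assoc]
  have hp'w : p' ≫ W.hom = (𝟙_ (Motives.SchemeOver ℂ)).hom := by
    rw [← Over.w i, ← Category.assoc, hp'y, Over.w y]
  exact hno (Over.homMk p' hp'w) (Over.OverMorphism.ext hp'y)

end Schemes

/-! ### §C The assembly: split fixed-point scheme + point count ⇒ fixed-point form -/

section Assembly

open AlgebraicGeometry Literature.AlgebraicGeometry.GroupActions

/-- A generalized point fixed by `g` is fixed by every element of `⟨g⟩ = Subgroup.zpowers g`. -/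
theorem comp_hom_eq_of_mem_zpowers {C : Type*} [Category C] {X T : C} (g : Aut X) (y : T ⟶ X)
    (hyg : y ≫ g.hom = y) : ∀ a ∈ Subgroup.zpowers g, y ≫ a.hom = y := by
  intro a ha
  rw [Subgroup.zpowers_eq_closure] at ha
  induction ha using Subgroup.closure_induction with
  | mem a ha =>
    rw [Set.mem_singleton_iff.mp ha]
    exact hyg
  | one => exact Category.comp_id y
  | mul a b _ _ iha ihb =>
    show y ≫ (b.hom ≫ a.hom) = y
    rw [← Category.assoc, ihb, iha]
  | inv a _ iha =>
    show y ≫ a.inv = y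
    calc y ≫ a.inv = (y ≫ a.hom) ≫ a.inv := by rw [iha]
      _ = y := by rw [Category.assoc, Iso.hom_inv_id, Category.comp_id]

/-- **The Kummer-point assembly lemma.**  Let `i : W ⟶ X` be a closed immersion of `ℂ`-schemes,
`g` an automorphism of `X`, and `j : F ⟶ X` the fixed-point object of `⟨g⟩` (D1 vocabulary).
Suppose `F` is SPLIT: the coproduct of finitely many sections `x k : Spec ℂ ⟶ F` (as for the
translations of `A[5]` on `K⁴(A)`, Oguiso 2020 Prop. 3.6), and that EXACTLY ONE of the points
`x k ≫ j`, namely `x k₀ = i(p₀)`, lies on `W`.  Then the `g`-fixed part of `W` is the single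
reduced point `p₀`: `i(p₀)` is `g`-fixed and every `T`-point `r` of `W` with `i(r)` `g`-fixed
factors as `r = (T → Spec ℂ) ≫ p₀` — the fixed-point form of I1geo at `(X, W, i, g)`. -/
theorem fixedPointForm_of_split_fixedPointObject {X W F : Motives.SchemeOver ℂ} (i : W ⟶ X)
    [IsClosedImmersion i.left] (g : Aut X) (j : F ⟶ X)
    (hj : IsFixedPointObject (Subgroup.zpowers g).subtype j)
    {n : ℕ} (x : Fin n → (𝟙_ (Motives.SchemeOver ℂ) ⟶ F)) (hx : IsColimit (Cofan.mk F x))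
    (k₀ : Fin n) (p₀ : 𝟙_ (Motives.SchemeOver ℂ) ⟶ W) (hp₀ : p₀ ≫ i = x k₀ ≫ j)
    (huniq : ∀ k, k ≠ k₀ → ∀ p : 𝟙_ (Motives.SchemeOver ℂ) ⟶ W, p ≫ i ≠ x k ≫ j) :
    (p₀ ≫ i) ≫ g.hom = p₀ ≫ i ∧
      ∀ ⦃T : Motives.SchemeOver ℂ⦄ (r : T ⟶ W), (r ≫ i) ≫ g.hom = r ≫ i → r = toUnit T ≫ p₀ := by
  haveI : Mono i := Over.mono_of_mono_left i
  have hjg : j ≫ g.hom = j := hj.comp_hom ⟨g, Subgroup.mem_zpowers g⟩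
  refine ⟨by rw [hp₀, Category.assoc, hjg], fun T r hr => ?_⟩
  -- `i(r)` is `⟨g⟩`-invariant, hence factors through the fixed-point object: `t : T ⟶ F`
  have hinv : ∀ a : Subgroup.zpowers g, (r ≫ i) ≫ ((Subgroup.zpowers g).subtype a).hom = r ≫ i :=
    fun a => comp_hom_eq_of_mem_zpowers g (r ≫ i) hr a.val a.property
  obtain ⟨t, ht, -⟩ := hj.existsUnique_fac (r ≫ i) hinv
  -- the fibres of `t` over the points `x k`, `k ≠ k₀`, are empty
  have h0 : ∀ k, k ≠ k₀ → IsInitial (pullback t (x k)) := by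
    intro k hk
    haveI : IsEmpty ↥(pullback t (x k)).left := by
      refine isEmpty_of_noSection i (x k ≫ j) (huniq k hk) (pullback.fst t (x k) ≫ r) ?_
      rw [Category.assoc, ← ht, ← Category.assoc, pullback.condition, Category.assoc,
        toUnit_unique (pullback.snd t (x k)) (toUnit _)]
    exact (nonempty_isInitial_over_of_isEmpty _).some
  -- hence `t` factors through `x k₀`, i.e. `t = toUnit ≫ x k₀`
  obtain ⟨s, hs⟩ := exists_fac_over x hx t (fun k => pullback t (x k)) (fun k => pullback.fst t (x k))
    (fun k => pullback.snd t (x k)) (fun k => IsPullback.of_hasPullback t (x k)) k₀ h0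
  have hs' : s = toUnit T := toUnit_unique _ _
  -- conclude with `i` mono
  apply (cancel_mono i).1
  rw [Category.assoc, hp₀, ← ht, hs, hs', Category.assoc]

end Assembly

/-! ### §D The restricted residual I1geo at the Kummer varieties from a SPLIT fixed-point scheme
(Oguiso's shape) and a POINT COUNT -/

section KummerPoint

open AlgebraicGeometry Literature.AlgebraicGeometry.GroupActions
open Literature.AlgebraicGeometry.Hyperkaehler

/-- **I1geo at the generalized Kummer varieties `K⁴(A)` from (i) the printed shape of the fixed
points of `Γ(K) = A[5]` — for `g ≠ 1` the fixed-point scheme of `⟨g⟩` is the coproduct of `125`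
sections `Spec ℂ ⟶ K^{⟨g⟩}` (Oguiso 2020 Prop. 3.6/3.5; the tree's named fact
`Hyperkaehler.Oguiso2020_fixedPointScheme_translation_generalizedKummerFour`, here an inline
hypothesis `hsplit`) — and (ii) the POINT COUNT `hcount`: for every Kummer fixed datum
`(ι₀, W₀, i₀)` on `K`, exactly one of those `125` points lies on `W₀` (the cell's elementary,
unpublished Kummer-point statement: the coset `⟨u⟩` is the only `(−1)`-symmetric one and lies on
`W₀`).  Also uses the printed `|Γ| = 625` (odd order).  Conclusion: the hypothesis `hgeo₀` of
`KummerFixedLocusKummerPointTransport` — I1geo for every `K⁴(A)`. -/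
theorem kum4FixedFourfoldMeetsTranslates_atKummerPoints_of_split_of_count
    (hcard : Floccari2026_card_autFixingH2H3_kum4Type)
    (hsplit : ∀ ⦃A : Motives.AbelianVariety ℂ⦄ ⦃K : Motives.SchemeOver ℂ⦄, A.dim = 2 →
      IsGeneralizedKummerVarietyOf 4 A K → Motives.IsSmoothProjective 8 K →
      ∀ g : autFixingH2H3 K, g ≠ 1 → ∀ ⦃F : Motives.SchemeOver ℂ⦄ (j : F ⟶ K),
        IsFixedPointScheme (Subgroup.zpowers g.val).subtype j →
        ∃ x : Fin 125 → (𝟙_ (Motives.SchemeOver ℂ) ⟶ F), Nonempty (IsColimit (Cofan.mk F x)))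
    (hcount : ∀ ⦃A : Motives.AbelianVariety ℂ⦄ ⦃K : Motives.SchemeOver ℂ⦄, A.dim = 2 →
      IsGeneralizedKummerVarietyOf 4 A K → Motives.IsSmoothProjective 8 K →
      ∀ (ι₀ : Aut K) ⦃W₀ : Motives.SchemeOver ℂ⦄ (i₀ : W₀ ⟶ K), IsKummerFixedDatum K ι₀ W₀ i₀ →
        ∀ g : autFixingH2H3 K, g ≠ 1 → ∀ ⦃F : Motives.SchemeOver ℂ⦄ (j : F ⟶ K),
          IsFixedPointScheme (Subgroup.zpowers g.val).subtype j →
          ∀ (x : Fin 125 → (𝟙_ (Motives.SchemeOver ℂ) ⟶ F)), Nonempty (IsColimit (Cofan.mk F x)) →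
            ∃ k₀ : Fin 125, (∃ p : 𝟙_ (Motives.SchemeOver ℂ) ⟶ W₀, p ≫ i₀ = x k₀ ≫ j) ∧
              ∀ k, k ≠ k₀ → ∀ p : 𝟙_ (Motives.SchemeOver ℂ) ⟶ W₀, p ≫ i₀ ≠ x k ≫ j) :
    ∀ ⦃A : Motives.AbelianVariety ℂ⦄ ⦃K : Motives.SchemeOver ℂ⦄, A.dim = 2 →
      IsGeneralizedKummerVarietyOf 4 A K → Motives.IsSmoothProjective 8 K →
      ∀ (ι₀ : Aut K) ⦃W₀ : Motives.SchemeOver ℂ⦄ (i₀ : W₀ ⟶ K), IsKummerFixedDatum K ι₀ W₀ i₀ →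
        ∀ g : autFixingH2H3 K, g ≠ 1 →
          ∃ (p q : 𝟙_ (Motives.SchemeOver ℂ) ⟶ W₀), IsPullback p q i₀ (i₀ ≫ g.val.hom) := by
  intro A K hA hKum hK8 ι₀ W₀ i₀ hd g hg
  -- `K` is of `Kum⁴`-type (constant family), separated; `Γ(K)` is finite of order `625`
  obtain ⟨M⟩ := HodgeTheory.nonempty_hodgeModel_holds (n := 8) (X := K) hK8
  have hKK : IsOfGeneralizedKummerType 4 K := IsOfGeneralizedKummerType.of_hodgeModel (n := 4) hA hKum hK8 M
  haveI : IsProper K.hom := hK8.isProjectiveOver.isProper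
  have hcardK : Nat.card (autFixingH2H3 K) = 625 := hcard hK8 hKK
  haveI : Finite (autFixingH2H3 K) := Nat.finite_of_card_ne_zero (by rw [hcardK]; norm_num)
  haveI : Finite (Subgroup.zpowers g.val) := by
    have hle : Subgroup.zpowers g.val ≤ autFixingH2H3 K := (Subgroup.zpowers_le).2 g.2
    exact Set.Finite.subset (Set.toFinite (autFixingH2H3 K : Set (Aut K))) hle
  -- the fixed-point scheme of `⟨g⟩`, split into `125` points, exactly one on `W₀`
  obtain ⟨F, j, hj⟩ := exists_isFixedPointScheme (Subgroup.zpowers g.val).subtype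
  obtain ⟨x, ⟨hx⟩⟩ := hsplit hA hKum hK8 g hg j hj
  obtain ⟨k₀, ⟨p₀, hp₀⟩, huniq⟩ := hcount hA hKum hK8 ι₀ i₀ hd g hg j hj x ⟨hx⟩
  haveI := hd.isClosedImmersion
  obtain ⟨hfix, huniv⟩ :=
    fixedPointForm_of_split_fixedPointObject i₀ g.val j hj.toIsFixedPointObject x hx k₀ p₀ hp₀ huniq
  -- from the fixed-point form to the pull-back square (`KummerFixedLocusFixedPointForm`)
  haveI : Mono i₀ := Over.mono_of_mono_left i₀
  have hconj : ι₀.hom ≫ g.val.hom ≫ ι₀.hom = g.val.inv := by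
    have h' := congrArg Iso.hom (hd.conj_eq_inv g.val g.2)
    simp only [Aut.Aut_mul_def, Aut.Aut_inv_def, Iso.trans_hom, Iso.symm_hom] at h'
    exact h'
  obtain ⟨m, hm⟩ := exists_pow_odd_eq_one_of_card hcardK g
  have hm' : (g : Aut K) ^ (2 * m + 1) = 1 := by exact_mod_cast hm
  exact ⟨p₀, p₀, (isPullback_unit_iff i₀ ι₀ g.val hd.comp_hom hconj
    (fun T y hy => comp_hom_eq_of_comp_hom_hom_eq g.val m hm' y hy) p₀ p₀).2 ⟨rfl, hfix, huniv⟩⟩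

/-- **H3 for `Kum⁴`-type and its powers from print + L1 + a POINT COUNT.**  Inputs: the eleven
REFEREED facts of `hc_kum4Type_of_L1_of_meetsTranslates`; the cohomological transport statement
`hT` (printed synthesis, the tree's named fact
`Hyperkaehler.HassettTschinkel2013_Floccari2026_fixedFourfoldClass_transport_kum4Type`, inline here);
the printed shape `hsplit` of the fixed points of `Γ(K⁴(A))` (Oguiso 2020 Prop. 3.6, the tree's named
fact `Hyperkaehler.Oguiso2020_fixedPointScheme_translation_generalizedKummerFour`, inline here); the
cell lemma L1; and the ONLY remaining non-print, non-L1 input — the point count `hcount` at the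
Kummer varieties.  HONEST FRAMING: conditional on every one of these; nothing is proved outright. -/
theorem hc_kum4Type_of_L1_of_count
    (hOGV : OGradyVoisin2022_thirdJacobian_kugaSatake_kummerType)
    (hFF : HodgeTheory.FloccariFu2026_hodgeClasses_algebraic_powers_discOneWeilFourfold)
    (hFo : Foster2024_lefschetzStandard_kummerType_prime)
    (hAn : HodgeTheory.Andre1996_dualLefschetz_mem_adjoin_lefschetzInvolution)
    (hA1 : HodgeTheory.Hirzebruch1969_gSignature_involution_halfDimFixedLocus)
    (hA2 : Floccari2026_fixedFourfold_kum4Type)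
    (hHIR : HodgeTheory.Voisin2002_hodgeIndex_hodgeRiemann_middle)
    (hGS : GoettscheSoergel1993_chiY_kum4Type)
    (hGK : GreenKimLazaRobles2022_llvTrivial_isOfHodgeType_kumType)
    (hF : Foster2024_translationAction_kum4Type)
    (hcardF : Floccari2026_card_autFixingH2H3_kum4Type)
    (hFu : HodgeTheory.Fulton1998_cupPairing_transversalPoint)
    (hT : ∀ ⦃X : Motives.SchemeOver ℂ⦄ (hX : Motives.IsSmoothProjective 8 X), IsOfGeneralizedKummerType 4 X →
      ∀ (ι : Aut X) ⦃W : Motives.SchemeOver ℂ⦄ (hW : Motives.IsSmoothProjective 4 W) (i : W ⟶ X),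
        IsKummerFixedDatum X ι W i →
        ∀ (w : Literature.AlgebraicTopology.SingularHomology.singularCohomology ℤ ℤ
            (Motives.ComplexPoints X) 8),
          Literature.AlgebraicTopology.SingularHomology.capProduct (M := ℤ) (rfl : 8 + 8 = 16) w
              (HodgeTheory.complexOrientationInt hX).fundamentalClass =
            Literature.AlgebraicTopology.SingularHomology.singularHomology.map ℤ ℤ
              (Motives.AlgPoints.mapContinuous (L := ℂ) i) 8
              (HodgeTheory.complexOrientationInt hW).fundamentalClass →
          ∃ (A : Motives.AbelianVariety ℂ) (K : Motives.SchemeOver ℂ)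
            (hK8 : Motives.IsSmoothProjective 8 K), A.dim = 2 ∧ IsGeneralizedKummerVarietyOf 4 A K ∧
            ∃ (ι₀ : Aut K) (W₀ : Motives.SchemeOver ℂ) (hW₀ : Motives.IsSmoothProjective 4 W₀)
              (i₀ : W₀ ⟶ K), IsKummerFixedDatum K ι₀ W₀ i₀ ∧
              ∃ (w₀ : Literature.AlgebraicTopology.SingularHomology.singularCohomology ℤ ℤ
                  (Motives.ComplexPoints K) 8),
                Literature.AlgebraicTopology.SingularHomology.capProduct (M := ℤ) (rfl : 8 + 8 = 16) w₀
                    (HodgeTheory.complexOrientationInt hK8).fundamentalClass =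
                  Literature.AlgebraicTopology.SingularHomology.singularHomology.map ℤ ℤ
                    (Motives.AlgPoints.mapContinuous (L := ℂ) i₀) 8
                    (HodgeTheory.complexOrientationInt hW₀).fundamentalClass ∧
                ∃ (θ : autFixingH2H3 K ≃* autFixingH2H3 X)
                  (P : HodgeTheory.complexBetti K 8 ≃ₗ[ℂ] HodgeTheory.complexBetti X 8),
                  (∀ (g : autFixingH2H3 K) (c : HodgeTheory.complexBetti K 8),
                    P (middleRep K g c) = middleRep X (θ g) (P c)) ∧
                  P (Literature.AlgebraicTopology.SingularHomology.singularCohomology.ringChange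
                      (algebraMap ℤ ℂ) (Motives.ComplexPoints K) 8 w₀) =
                    Literature.AlgebraicTopology.SingularHomology.singularCohomology.ringChange
                      (algebraMap ℤ ℂ) (Motives.ComplexPoints X) 8 w)
    (hsplit : ∀ ⦃A : Motives.AbelianVariety ℂ⦄ ⦃K : Motives.SchemeOver ℂ⦄, A.dim = 2 →
      IsGeneralizedKummerVarietyOf 4 A K → Motives.IsSmoothProjective 8 K →
      ∀ g : autFixingH2H3 K, g ≠ 1 → ∀ ⦃F : Motives.SchemeOver ℂ⦄ (j : F ⟶ K),
        IsFixedPointScheme (Subgroup.zpowers g.val).subtype j →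
        ∃ x : Fin 125 → (𝟙_ (Motives.SchemeOver ℂ) ⟶ F), Nonempty (IsColimit (Cofan.mk F x)))
    (hcount : ∀ ⦃A : Motives.AbelianVariety ℂ⦄ ⦃K : Motives.SchemeOver ℂ⦄, A.dim = 2 →
      IsGeneralizedKummerVarietyOf 4 A K → Motives.IsSmoothProjective 8 K →
      ∀ (ι₀ : Aut K) ⦃W₀ : Motives.SchemeOver ℂ⦄ (i₀ : W₀ ⟶ K), IsKummerFixedDatum K ι₀ W₀ i₀ →
        ∀ g : autFixingH2H3 K, g ≠ 1 → ∀ ⦃F : Motives.SchemeOver ℂ⦄ (j : F ⟶ K),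
          IsFixedPointScheme (Subgroup.zpowers g.val).subtype j →
          ∀ (x : Fin 125 → (𝟙_ (Motives.SchemeOver ℂ) ⟶ F)), Nonempty (IsColimit (Cofan.mk F x)) →
            ∃ k₀ : Fin 125, (∃ p : 𝟙_ (Motives.SchemeOver ℂ) ⟶ W₀, p ≫ i₀ = x k₀ ≫ j) ∧
              ∀ k, k ≠ k₀ → ∀ p : 𝟙_ (Motives.SchemeOver ℂ) ⟶ W₀, p ≫ i₀ ≠ x k ≫ j)
    (hL1 : LefschetzGenerationKum4) :
    Summit.Ventures.HodgeKum4.HC_Kum4Type ∧ Summit.Ventures.HodgeKum4.HC_Kum4TypePowers :=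
  hc_kum4Type_of_L1_of_kummerPoint hT
    (kum4FixedFourfoldMeetsTranslates_atKummerPoints_of_split_of_count hcardF hsplit hcount)
    hOGV hFF hFo hAn hA1 hA2 hHIR hGS hGK hF hcardF hFu hL1

end KummerPoint

end Summit.Ventures.HodgeKum4

end
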